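import Summits.QuantumFields.BalabanUV.Beta.EriceRemainderEnclosureHistoryAutonomyComparisonAgeCompositionPairShares

/-!
# EriceRemainderEnclosureHistoryAutonomyComparisonAgeCompositionFarOldSharp — (E94a) route (N), first order: THE WEDGE R2 WITH ITS EXACT CONSTANT,
# AND THE CENSUS THREE AGES `{1, 2, k₃}` AT EVERY `k₃`.  (E91c) `flow_nonneg_three_ages_far_old` closes the END when the young pair `{1, k₂}` carries
# `≤ 1 − δ` and `10·k₂ ≤ δ·k₃`; the `10` rounds the mechanism's exact letter `2√2·(1−δ)·k₂ ≤ (1 − √2∕2)·δ·k₃` (young contraction `1 − sy`, old cap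
# `√2∕2`, old-read variation `4k₂c₃ ≤ 2√2·k₂∕k₃`), losing the factor `(1−δ)` and `2√2∕(1−√2∕2) = 9.66 < 10`.  With the exact letter and the pair share
# bound `x₁ + x₂ ≤ √2∕(1+p₀)` ((E92b) `pair_load_le_of_ratio`) the R2 threshold drops from `10k₂(1+p₀)∕(1+p₀−√2)` to `9.66·√2·k₂∕(1+p₀−√2)`:
# `78 → 56` at `k₂ = 2`, `130 → 96` at `3`, `189 → 143` at `4`, `1047 → 885` at `13`.  Since (E90c) `flow_nonneg_three_ages` covers `k₃ ≤ 56`, THE ROW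
# `k₂ = 2` OF THE CENSUS THREE AGES IS CLOSED: for the profile `{1, 2, k₃}`, every `2 < k₃ < K ≤ N`, every admissible flow, every damping of the
# self-consistent class: `0 ≤ ε ≤ e`

Cell `pub-balaban`, β-function sub-cell, BINDER row D4 «RemainderConst leaves for Bałaban's split» (`HOME/BINDER-OWNERS.md`; owner lineage `b2b-balaban-beta-an4`;
this file by co-owner #2 lineage `b2b-balaban-beta-d4-p2`, generation 84), β-FLOW TEAM duty (1), FREEZE (0) honoured (def-free; nothing restated).

HONEST FRAMING (page 1, verbatim and binding).  *"Discharging BetaPertH makes Bałaban's UV stability UNCONDITIONAL — a real constructive-QFT result; it is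
NOT the continuum limit and NOT the Clay problem."*  THIS FILE DISCHARGES NOTHING OF THE KIND.  Elementary real algebra ∕ real analysis about ABSTRACT
functionals on a box ]0,γ]^ℕ with displayed floors, profiles and signs, and the FIRST-ORDER renewal objects of route (N) built from them — hypotheses of a
census, not facts; the form, signs, ages and moments of Bałaban's (1.22) limit functional are NOT PRINTED ([I] p. 298; GAPS G-t4-U2-1∕-2) and NOT asserted.
Row D4 class UNCHANGED (critical-path width 0; instance 0∕1; D4 DISCHARGE NO DATE).  HONEST DEPENDENCY: continuum YM on T⁴ ⇐ BetaPertH ∧ nine spine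
estimates (0/9 proved); BetaPertH ⇐ (D1) ∧ (D4) ∧ CAP+tail; G-an2-4 gates asym, D1 and NE2/3/4.

THE POINT (README `HOME/b2b-balaban-beta-d4-p2/g84/README.md` §1).  (E91b) `renewal_nonneg_two_reads` needs `sy·V ≤ (1−sy)(1−so)`; for the wedge R2
`sy = 1 − δ` (young pair), `so = √2∕2` (old cap, (E89b)), `V = 4k₂·c₃ ≤ 2√2·k₂∕k₃` ((E91a) `old_read_variation` over the young pair's window `d ≤ k₂`);
this file keeps that letter as printed by the mechanism instead of the rounded `10k₂ ≤ δk₃`.  Uses (E91b) `renewal_nonneg_two_reads`, (E91a)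
`old_read_variation`, (E92b) `pair_load_le_of_ratio`, (E90c) `flow_nonneg_three_ages`, (E89b) `window_load_le_sqrt_two_div_two`, (E82a)
`kernel_entry_le`∕`row_mass_le`, (E80b) `aggregate_eq_sum` BY NAME.  NOT CLAIMED: `k₂ ≥ 3` below the sharpened threshold (`57 ≤ k₃ ≤ 95` at `k₂ = 3` …) —
that is the total-load (mass) certificate of README §3; anything printed — NOT B12 Thm 2, NOT BetaPertH, NOT continuum, NOT Clay.

WHAT IS PROVED ([folklore]; 0 `def`, 0 sorry).  §1 **`flow_nonneg_three_ages_far_old_sharp`** (wedge R2 with the exact letter `2√2(1−δ)k₂ ≤ (1−√2∕2)δk₃`),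
**`flow_nonneg_three_ages_young_pair_sharp`** (R2 discharged by the pair share bound, parametric `p₀`).  §2 `sqrt_two_bounds`, `far_old_sharp_numerics_two`,
**`flow_nonneg_census_three_ages_middle_two`** (`{1, 2, k₃}`: EVERY `k₃`).
-/
noncomputable section
open Finset

namespace Summit.QuantumFields.BalabanUV.Beta.EriceRemainderEnclosureHistoryAutonomyComparisonAgeCompositionFarOldSharp

open Literature.MathematicalPhysics.QuantumFieldTheory.Balaban1983to89
open Literature.MathematicalPhysics.QuantumFieldTheory.Balaban1983to89.T4BetaStationary
open Literature.MathematicalPhysics.QuantumFieldTheory.Balaban1983to89.T4BetaFlowWellPosed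
open Summit.QuantumFields.BalabanUV.Beta.EriceRemainderEnclosureHistoryAutonomyComparisonAgeCompositionThreeAgesMassCap
  (window_load_le_sqrt_two_div_two)
open Summit.QuantumFields.BalabanUV.Beta.EriceRemainderEnclosureHistoryAutonomyComparisonAgeCompositionYoungestTailSumFlow
  (kernel_entry_le row_mass_le)
open Summit.QuantumFields.BalabanUV.Beta.EriceRemainderEnclosureHistoryAutonomyComparisonAgeCompositionChainWiring (aggregate_eq_sum)
open Summit.QuantumFields.BalabanUV.Beta.EriceRemainderEnclosureHistoryAutonomyComparisonAgeCompositionTwoAgesOldRead (old_read_variation)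
open Summit.QuantumFields.BalabanUV.Beta.EriceRemainderEnclosureHistoryAutonomyComparisonAgeCompositionTwoAgesFar (renewal_nonneg_two_reads)
open Summit.QuantumFields.BalabanUV.Beta.EriceRemainderEnclosureHistoryAutonomyComparisonAgeCompositionPairShares (pair_load_le_of_ratio)
open Summit.QuantumFields.BalabanUV.Beta.EriceRemainderEnclosureHistoryAutonomyComparisonAgeCompositionThreeAgesTotalLoad (flow_nonneg_three_ages)

variable {B : (ℕ → ℝ) → ℝ} {γ b gIR : ℝ} {L : ℕ → ℝ} {K : ℕ} {h g : ℕ → ℝ}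

/-! ## §1 The wedge R2 with the mechanism's exact letter -/

/-- **WEDGE R2 WITH ITS EXACT CONSTANT.**  The census three ages `{1, k₂, k₃}`, `2 ≤ k₂ < k₃ < K`, every horizon, every damping of the self-consistent
class; IF the young pair's window load is `≤ 1 − δ` at every pin and `2√2·(1−δ)·k₂ ≤ (1 − √2∕2)·δ·k₃`, THEN `0 ≤ ε ≤ e` — (E91b) `renewal_nonneg_two_reads`
with `sy = 1 − δ`, `so = √2∕2`, `V = 2√2·k₂∕k₃`, the letter `sy·V ≤ (1−sy)(1−so)` kept as is ((E91c) `flow_nonneg_three_ages_far_old` rounds it to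
`10k₂ ≤ δk₃`). [folklore] -/
theorem flow_nonneg_three_ages_far_old_sharp (hmono : ∀ u v : ℕ → ℝ, SeqBox γ u → SeqBox γ v → (∀ j, u j ≤ v j) → B u ≤ B v)
    (hL : ∀ k, 0 ≤ L k) (hb : 0 < b) (hlo : ∀ u, SeqBox γ u → b ≤ B u) (hdom : ∀ u, SeqBox γ u → ∑ k ∈ range K, L k * u k ≤ B u)
    (hh : SeqBox γ h) (hf : MemFlow B gIR h) (hg : ∀ t, 0 < g t ∧ g t ≤ 1)
    (hgF : ∀ t, 1 ≤ g t * (1 + ∑ k ∈ range K, L k * h (t + k) ^ 3 / 2))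
    {k₂ k₃ : ℕ} (hk2 : 2 ≤ k₂) (hk23 : k₂ < k₃) (hk3K : k₃ < K) (hL3 : ∀ j, j < K → j ≠ 1 → j ≠ k₂ → j ≠ k₃ → L j = 0)
    {δ : ℝ} (hδ : 0 < δ) (hfar : 2 * Real.sqrt 2 * (1 - δ) * k₂ ≤ (1 - Real.sqrt 2 / 2) * δ * k₃)
    (hyoung : ∀ m, L 1 * h (m + 1) ^ 3 / 2 + (k₂ : ℝ) * (L k₂ * h (m + k₂) ^ 3 / 2) ≤ 1 - δ)
    {N : ℕ} {KL : ℕ → ℕ → ℕ → ℝ}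
    (hKL : ∀ k n l, KL k n l = if 0 < k ∧ k < K ∧ l < k then L k * h (n + k) ^ 3 / 2 * ∏ t ∈ Ico (n + 1 + l) (n + k + 1), g t else 0)
    {KA : ℕ → ℕ → ℕ → ℝ} {RA : ℕ → (ℕ → ℝ) → ℕ → ℝ}
    (hRA : ∀ i v m, RA i v m = ∑ l ∈ range K, KA i m l * v (m + 1 + l))
    (hKA : ∀ i m l, KA i m l = KL i m l + KA (i + 1) m l) (hKAtop : ∀ m l, KA K m l = 0)
    {e ε : ℕ → ℝ} (he0 : ∀ m, 0 ≤ e m) (hea : ∀ m, e (m + 1) ≤ e m)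
    (hεt : ∀ m, N < m → ε m = 0) (hεrec : ∀ m, ε m = e m - RA 1 ε m) : ∀ m, 0 ≤ ε m ∧ ε m ≤ e m := by
  have hpos : ∀ n, 0 < h n := fun n => (hh n).1
  have hs2 : Real.sqrt 2 ^ 2 = 2 := Real.sq_sqrt (by norm_num)
  have hs0 : 0 ≤ Real.sqrt 2 := Real.sqrt_nonneg 2
  have hs17 : Real.sqrt 2 ≤ 17 / 12 := Real.sqrt_le_iff.mpr ⟨by norm_num, by norm_num⟩
  have hK : 1 ≤ K := by omega
  have h1K : 1 < K := by omega
  have hk2K : k₂ < K := by omega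
  have hk3 : 0 < k₃ := by omega
  have hk2r : (0 : ℝ) < k₂ := by exact_mod_cast (show 0 < k₂ by omega)
  have hk3r : (0 : ℝ) < k₃ := by exact_mod_cast hk3
  have hL0 : L 0 = 0 := hL3 0 (by omega) (by omega) (by omega) (by omega)
  -- the aggregate row is the young pair's rows plus the old row
  have hKA1 : ∀ m l, KA 1 m l = (KL 1 m l + KL k₂ m l) + KL k₃ m l := by
    intro m l
    have h1 : KA 1 m l = ∑ k' ∈ Ico 1 (K - 1 + 1), KL k' m l :=
      aggregate_eq_sum (n := K - 1) hKA (fun m l => by rw [Nat.sub_add_cancel hK]; exact hKAtop m l) (show 1 ≤ K - 1 + 1 by omega) m l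
    rw [h1, Nat.sub_add_cancel hK]
    have hsub : ({1, k₂, k₃} : Finset ℕ) ⊆ Ico 1 K := by
      intro j hj
      simp only [mem_insert, mem_singleton] at hj
      rw [mem_Ico]; rcases hj with rfl | rfl | rfl <;> omega
    rw [← sum_subset hsub (fun j hj hjn => by
      simp only [mem_insert, mem_singleton, not_or] at hjn
      rw [hKL]
      split_ifs
      · rw [hL3 j (mem_Ico.mp hj).2 hjn.1 hjn.2.1 hjn.2.2]; simp
      · rfl), sum_insert (by simp only [mem_insert, mem_singleton]; omega), sum_pair (by omega)]
    ring
  -- the young pair's row sums: ≤ d_m + x₂(m) ≤ 1 − δ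
  have hWy : ∀ m, ∑ l ∈ range K, (KL 1 m l + KL k₂ m l) ≤ 1 - δ := by
    intro m
    rw [sum_add_distrib]
    have h1 := row_mass_le hL hh hg hKL h1K m
    have h2 := row_mass_le hL hh hg hKL hk2K m
    have := hyoung m
    simp only [Nat.cast_one, one_mul] at h1
    linarith
  refine renewal_nonneg_two_reads (i := k₂) (N := N) (Kw := K) (sy := 1 - δ) (so := Real.sqrt 2 / 2) (V := 2 * Real.sqrt 2 * k₂ / k₃)
    (wy := fun m l => KL 1 m l + KL k₂ m l) (wo := fun m l => KL k₃ m l)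
    (Y := fun m => ∑ l ∈ range K, (KL 1 m l + KL k₂ m l) * ε (m + 1 + l)) (O := fun m => ∑ l ∈ range K, KL k₃ m l * ε (m + 1 + l))
    (fun m l => add_nonneg (kernel_entry_le hL hh hg hKL 1 m l).1 (kernel_entry_le hL hh hg hKL k₂ m l).1)
    (fun m l hl => by rw [hKL, if_neg (by omega), hKL, if_neg (by omega), add_zero]) hWy
    (fun m l => (kernel_entry_le hL hh hg hKL k₃ m l).1)
    (fun m => (row_mass_le hL hh hg hKL hk3K m).trans (window_load_le_sqrt_two_div_two hmono hL hb hlo hdom hh hf hk3K m))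
    (by linarith) (by linarith [hs17]) (by positivity) ?_ (fun _ => rfl) (fun _ => rfl) he0 hea ?_ hεt ?_
  · -- (1−δ)·(2√2 k₂∕k₃) ≤ δ·(1 − √2∕2): the displayed letter, divided by k₃
    rw [show (1 : ℝ) - (1 - δ) = δ by ring]
    have h1 : (1 - δ) * (2 * Real.sqrt 2 * k₂ / k₃) = (2 * Real.sqrt 2 * (1 - δ) * k₂) / k₃ := by ring
    rw [h1, div_le_iff₀ hk3r]
    linarith
  · -- the old read varies slowly over the young pair's window (d ≤ k₂ < k₃)
    intro m d hd1 hdk2 IH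
    have hdk3 : d ≤ k₃ := by omega
    have hv := old_read_variation hmono hL hb hlo hdom hh hf hL0 hg hgF hKL hk3 hk3K hd1 hdk3 he0 hea IH
    have hx := window_load_le_sqrt_two_div_two hmono hL hb hlo hdom hh hf hk3K m
    have hc0 : 0 ≤ L k₃ * h (m + k₃) ^ 3 / 2 := by have := hL k₃; have := hpos (m + k₃); positivity
    have hem := he0 m
    have hdr : (d : ℝ) ≤ k₂ := by exact_mod_cast hdk2
    have h4 : 4 * (d : ℝ) * (L k₃ * h (m + k₃) ^ 3 / 2) * e m ≤ 2 * Real.sqrt 2 * k₂ / k₃ * e m := by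
      refine mul_le_mul_of_nonneg_right ?_ hem
      rw [le_div_iff₀ hk3r]
      nlinarith [mul_le_mul_of_nonneg_right hdr hc0]
    simpa using hv.trans h4
  · intro m
    rw [hεrec m, hRA]
    have : ∑ l ∈ range K, KA 1 m l * ε (m + 1 + l)
        = ∑ l ∈ range K, (KL 1 m l + KL k₂ m l) * ε (m + 1 + l) + ∑ l ∈ range K, KL k₃ m l * ε (m + 1 + l) := by
      rw [← sum_add_distrib]; exact sum_congr rfl fun l _ => by rw [hKA1]; ring
    rw [this]; ring

/-- **WEDGE R2 DISCHARGED WITH THE EXACT CONSTANT.**  The census three ages `{1, k₂, k₃}`; any `p₀ ≥ 0` with `p₀⁴(k₂+1) ≤ 2`, so that the young pair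
carries `≤ σ = √2∕(1+p₀)` at every pin ((E92b) `pair_load_le_of_ratio`); IF `2√2·σ·k₂ ≤ (1 − √2∕2)(1 − σ)·k₃` THEN `0 ≤ ε ≤ e` along every flow, every
horizon, every damping of the self-consistent class.  Thresholds: `k₃ ≥ 56` (`k₂ = 2`), `96` (`3`), `143` (`4`), `198` (`5`), `258` (`6`), `326` (`7`),
`401` (`8`), `885` (`13`). [folklore] -/
theorem flow_nonneg_three_ages_young_pair_sharp (hmono : ∀ u v : ℕ → ℝ, SeqBox γ u → SeqBox γ v → (∀ j, u j ≤ v j) → B u ≤ B v)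
    (hL : ∀ k, 0 ≤ L k) (hb : 0 < b) (hlo : ∀ u, SeqBox γ u → b ≤ B u) (hdom : ∀ u, SeqBox γ u → ∑ k ∈ range K, L k * u k ≤ B u)
    (hh : SeqBox γ h) (hf : MemFlow B gIR h) (hg : ∀ t, 0 < g t ∧ g t ≤ 1)
    (hgF : ∀ t, 1 ≤ g t * (1 + ∑ k ∈ range K, L k * h (t + k) ^ 3 / 2))
    {k₂ k₃ : ℕ} (hk2 : 2 ≤ k₂) (hk23 : k₂ < k₃) (hk3K : k₃ < K) (hL3 : ∀ j, j < K → j ≠ 1 → j ≠ k₂ → j ≠ k₃ → L j = 0)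
    {p₀ : ℝ} (hp0 : 0 ≤ p₀) (hp : p₀ ^ 4 * ((k₂ : ℝ) + 1) ≤ 2)
    (hfar : 2 * Real.sqrt 2 * (Real.sqrt 2 / (1 + p₀)) * k₂ ≤ (1 - Real.sqrt 2 / 2) * (1 - Real.sqrt 2 / (1 + p₀)) * k₃)
    {N : ℕ} {KL : ℕ → ℕ → ℕ → ℝ}
    (hKL : ∀ k n l, KL k n l = if 0 < k ∧ k < K ∧ l < k then L k * h (n + k) ^ 3 / 2 * ∏ t ∈ Ico (n + 1 + l) (n + k + 1), g t else 0)
    {KA : ℕ → ℕ → ℕ → ℝ} {RA : ℕ → (ℕ → ℝ) → ℕ → ℝ}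
    (hRA : ∀ i v m, RA i v m = ∑ l ∈ range K, KA i m l * v (m + 1 + l))
    (hKA : ∀ i m l, KA i m l = KL i m l + KA (i + 1) m l) (hKAtop : ∀ m l, KA K m l = 0)
    {e ε : ℕ → ℝ} (he0 : ∀ m, 0 ≤ e m) (hea : ∀ m, e (m + 1) ≤ e m)
    (hεt : ∀ m, N < m → ε m = 0) (hεrec : ∀ m, ε m = e m - RA 1 ε m) : ∀ m, 0 ≤ ε m ∧ ε m ≤ e m := by
  have hs0 : 0 ≤ Real.sqrt 2 := Real.sqrt_nonneg 2
  have hs17 : Real.sqrt 2 ≤ 17 / 12 := Real.sqrt_le_iff.mpr ⟨by norm_num, by norm_num⟩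
  have hk2r : (0 : ℝ) < k₂ := by exact_mod_cast (show 0 < k₂ by omega)
  have hk3r : (0 : ℝ) < k₃ := by exact_mod_cast (show 0 < k₃ by omega)
  have h1p : 0 < 1 + p₀ := by linarith
  have hs1 : 1 ≤ Real.sqrt 2 := Real.one_le_sqrt.mpr (by norm_num)
  have hσ0 : 0 < Real.sqrt 2 / (1 + p₀) := by positivity
  have hδ : 0 < 1 - Real.sqrt 2 / (1 + p₀) := by
    by_contra hneg
    have h1 : (1 - Real.sqrt 2 / 2) * (1 - Real.sqrt 2 / (1 + p₀)) * k₃ ≤ 0 :=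
      mul_nonpos_of_nonpos_of_nonneg (mul_nonpos_of_nonneg_of_nonpos (by linarith) (not_lt.mp hneg)) hk3r.le
    have h2 : 0 < 2 * Real.sqrt 2 * (Real.sqrt 2 / (1 + p₀)) * k₂ := by positivity
    linarith
  have h2K : k₂ < K := lt_trans hk23 hk3K
  refine flow_nonneg_three_ages_far_old_sharp hmono hL hb hlo hdom hh hf hg hgF hk2 hk23 hk3K hL3 hδ ?_ (fun m => ?_) hKL hRA hKA hKAtop
    he0 hea hεt hεrec
  · rw [show (1 : ℝ) - (1 - Real.sqrt 2 / (1 + p₀)) = Real.sqrt 2 / (1 + p₀) by ring]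
    exact hfar
  · rw [show (1 : ℝ) - (1 - Real.sqrt 2 / (1 + p₀)) = Real.sqrt 2 / (1 + p₀) by ring]
    have := pair_load_le_of_ratio hmono hL hb hlo hdom hh hf le_rfl (show 1 < k₂ by omega) h2K hp0 (by push_cast; linarith) m
    simpa using this

/-! ## §2 The row `k₂ = 2` of the census three ages: every `k₃` -/

/-- `1.41421 ≤ √2 ≤ 1.41422`. [folklore] -/
theorem sqrt_two_bounds : (141421 : ℝ) / 100000 ≤ Real.sqrt 2 ∧ Real.sqrt 2 ≤ 141422 / 100000 :=
  ⟨(Real.le_sqrt (by norm_num) (by norm_num)).mpr (by norm_num), Real.sqrt_le_iff.mpr ⟨by norm_num, by norm_num⟩⟩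

/-- The numerics of the sharpened wedge R2 at `k₂ = 2`: with `p₀ = 9035∕10000` (`p₀⁴·3 ≤ 2`) and `σ = √2∕(1+p₀)`, `2√2·σ·2 ≤ (1 − √2∕2)(1 − σ)·k₃` for every
`k₃ ≥ 56` (`8∕1.9035 = 4.2028 ≤ 0.29289·0.25704·56 = 4.2160`). [folklore] -/
theorem far_old_sharp_numerics_two {k₃ : ℝ} (hk3 : 56 ≤ k₃) :
    2 * Real.sqrt 2 * (Real.sqrt 2 / (1 + 9035 / 10000)) * (2 : ℝ)
      ≤ (1 - Real.sqrt 2 / 2) * (1 - Real.sqrt 2 / (1 + 9035 / 10000)) * k₃ := by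
  obtain ⟨hlo, hhi⟩ := sqrt_two_bounds
  have hs2 : Real.sqrt 2 * Real.sqrt 2 = 2 := Real.mul_self_sqrt (by norm_num)
  have hl : 2 * Real.sqrt 2 * (Real.sqrt 2 / (1 + 9035 / 10000)) * (2 : ℝ) = 8 / (1 + 9035 / 10000) := by
    rw [show 2 * Real.sqrt 2 * (Real.sqrt 2 / (1 + 9035 / 10000)) * (2 : ℝ)
      = 4 * (Real.sqrt 2 * Real.sqrt 2) / (1 + 9035 / 10000) by ring, hs2]; norm_num
  rw [hl]
  have ha : (29289 : ℝ) / 100000 ≤ 1 - Real.sqrt 2 / 2 := by linarith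
  have hb : (25704 : ℝ) / 100000 ≤ 1 - Real.sqrt 2 / (1 + 9035 / 10000) := by
    have : Real.sqrt 2 / (1 + 9035 / 10000) ≤ 74296 / 100000 := by
      rw [div_le_iff₀ (by norm_num : (0 : ℝ) < 1 + 9035 / 10000)]; linarith
    linarith
  have hab : (29289 : ℝ) / 100000 * (25704 / 100000) ≤ (1 - Real.sqrt 2 / 2) * (1 - Real.sqrt 2 / (1 + 9035 / 10000)) :=
    mul_le_mul ha hb (by norm_num) (by linarith)
  calc (8 : ℝ) / (1 + 9035 / 10000) ≤ 29289 / 100000 * (25704 / 100000) * 56 := by norm_num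
    _ ≤ (1 - Real.sqrt 2 / 2) * (1 - Real.sqrt 2 / (1 + 9035 / 10000)) * 56 :=
        mul_le_mul_of_nonneg_right hab (by norm_num)
    _ ≤ (1 - Real.sqrt 2 / 2) * (1 - Real.sqrt 2 / (1 + 9035 / 10000)) * k₃ :=
        mul_le_mul_of_nonneg_left hk3 ((by norm_num : (0 : ℝ) ≤ 29289 / 100000 * (25704 / 100000)).trans hab)

/-- **THE CENSUS THREE AGES `{1, 2, k₃}` AT EVERY `k₃`.**  `B` an isotone memory on the box with floor `b > 0` dominating the profile `L ≥ 0` carried by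
`{1, 2, k₃}`, `2 < k₃ < K`; `h` a box solution; dampings `0 < g ≤ 1` of the self-consistent class; horizon `N ≥ K`; `e ≥ 0` non-increasing; `ε` the
first-order comparison solution.  THEN `0 ≤ ε ≤ e` at every pin: `k₃ ≤ 56` by (E90c) `flow_nonneg_three_ages` (total window load `≤ 1`), `k₃ ≥ 56` by
`flow_nonneg_three_ages_young_pair_sharp` with `p₀ = 0.9035`.  The first small-`k₂` row of «three ages at every ratio» that is closed. [folklore] -/
theorem flow_nonneg_census_three_ages_middle_two (hmono : ∀ u v : ℕ → ℝ, SeqBox γ u → SeqBox γ v → (∀ j, u j ≤ v j) → B u ≤ B v)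
    (hL : ∀ k, 0 ≤ L k) (hb : 0 < b) (hlo : ∀ u, SeqBox γ u → b ≤ B u) (hdom : ∀ u, SeqBox γ u → ∑ k ∈ range K, L k * u k ≤ B u)
    (hh : SeqBox γ h) (hf : MemFlow B gIR h) (hg : ∀ t, 0 < g t ∧ g t ≤ 1)
    (hgF : ∀ t, 1 ≤ g t * (1 + ∑ k ∈ range K, L k * h (t + k) ^ 3 / 2))
    {k₃ : ℕ} (hk23 : 2 < k₃) (hk3K : k₃ < K) (hL3 : ∀ j, j < K → j ≠ 1 → j ≠ 2 → j ≠ k₃ → L j = 0)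
    {N : ℕ} (hKN : K ≤ N) {KL : ℕ → ℕ → ℕ → ℝ}
    (hKL : ∀ k n l, KL k n l = if 0 < k ∧ k < K ∧ l < k then L k * h (n + k) ^ 3 / 2 * ∏ t ∈ Ico (n + 1 + l) (n + k + 1), g t else 0)
    {KA : ℕ → ℕ → ℕ → ℝ} {RA : ℕ → (ℕ → ℝ) → ℕ → ℝ}
    (hRA : ∀ i v m, RA i v m = ∑ l ∈ range K, KA i m l * v (m + 1 + l))
    (hKA : ∀ i m l, KA i m l = KL i m l + KA (i + 1) m l) (hKAtop : ∀ m l, KA K m l = 0)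
    {e ε : ℕ → ℝ} (he0 : ∀ m, 0 ≤ e m) (hea : ∀ m, e (m + 1) ≤ e m)
    (hεt : ∀ m, N < m → ε m = 0) (hεrec : ∀ m, ε m = e m - RA 1 ε m) : ∀ m, 0 ≤ ε m ∧ ε m ≤ e m := by
  by_cases h56 : k₃ ≤ 56
  · exact flow_nonneg_three_ages hmono hL hb hlo hdom hh hf hg (k₂ := 2) le_rfl hk23 hk3K h56 hL3 hKN hKL hRA hKA hKAtop he0 hea hεt hεrec
  · have hk3r : (56 : ℝ) ≤ k₃ := by exact_mod_cast (show 56 ≤ k₃ by omega)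
    exact flow_nonneg_three_ages_young_pair_sharp hmono hL hb hlo hdom hh hf hg hgF (k₂ := 2) le_rfl hk23 hk3K hL3
      (p₀ := 9035 / 10000) (by norm_num) (by norm_num) (by push_cast; exact far_old_sharp_numerics_two hk3r)
      hKL hRA hKA hKAtop he0 hea hεt hεrec

end Summit.QuantumFields.BalabanUV.Beta.EriceRemainderEnclosureHistoryAutonomyComparisonAgeCompositionFarOldSharp

end
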